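/-
Copyright (c) 2026. All rights reserved.
Released under Apache 2.0 license as described in the file LICENSE.
Authors: abc-iut cell, seat abc-iut-L4-t15 (gen 6).
-/
import Literature.GroupTheory.ProfiniteClosureFiniteWidth
import Mathlib.Topology.Algebra.Group.ClosedSubgroup
import Mathlib.GroupTheory.Index
import Mathlib.GroupTheory.OrderOfElement
import Mathlib.Tactic.Group

/-!
# Open subgroups of a "procyclic modulo a normal subgroup" closed subgroup

Let `G` be a compact topological group, `P ⊴ G` a normal subgroup and `t ∈ G`; put
`C = cl(⟨t⟩P)` (the closure of the subgroup `zpowers t ⊔ P`).  For an open normal subgroup `U ⊇ P` of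
`G` we prove (`exists_pow_mem_closure_inter_eq`): there is `m ≥ 1` with `t ^ m ∈ U` and

  `C ∩ U = cl(⟨t ^ m⟩ P)`.

This is the elementary fact "an open subgroup of index `m` of a procyclic group `cl⟨t̄⟩` is
`cl⟨t̄ ^ m⟩`", stated modulo the normal subgroup `P` and inside `G` (no quotient topology).  It is the
tool needed to transport the `p`-by-metacyclic profinite setting of
`Literature/GroupTheory/ProfiniteCommutatorWidthPByMetacyclic.lean` to open subgroups `U ⊇ P`
(take `t_U = t ^ m`).  [cite: RibesZalesskii2010, §2.7]  Mathlib-only; no definitions, no instances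
(cell abc-iut, GAP-LEDGER G-L3d2g2-1).
-/

namespace Literature.GroupTheory

open scoped Pointwise

variable {G : Type*} [Group G] [TopologicalSpace G] [IsTopologicalGroup G] [CompactSpace G]

/-- **Open subgroups of `cl(⟨t⟩P)` containing `P`.**  Let `P ⊴ G`, `t ∈ G`, and let `U ⊴ G` be an
open normal subgroup with `P ≤ U`.  Then for some `m ≥ 1` with `t ^ m ∈ U`, the intersection of
`cl(⟨t⟩ P)` with `U` is `cl(⟨t ^ m⟩ P)`. [cite: RibesZalesskii2010, §2.7] -/
theorem exists_pow_mem_closure_inter_eq (P : Subgroup G) [hP : P.Normal] (t : G)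
    (U : Subgroup G) [hU : U.Normal] (hUo : IsOpen (U : Set G)) (hPU : P ≤ U) :
    ∃ m : ℕ, 0 < m ∧ t ^ m ∈ U ∧
      closure ((Subgroup.zpowers t ⊔ P : Subgroup G) : Set G) ∩ (U : Set G) =
        closure ((Subgroup.zpowers (t ^ m) ⊔ P : Subgroup G) : Set G) := by
  classical
  set S : Subgroup G := Subgroup.zpowers t ⊔ P with hS
  set Cs : Subgroup G := S.topologicalClosure with hCs
  have hCsc : IsClosed (Cs : Set G) := S.isClosed_topologicalClosure
  have hCs_eq : (Cs : Set G) = closure (S : Set G) := rfl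
  -- `D = Cs ∩ U`, of finite index `m` in `Cs`, normal in `Cs`
  set D : Subgroup Cs := U.subgroupOf Cs with hD
  haveI hDn : D.Normal := Subgroup.normal_subgroupOf
  have hUc : IsClosed (U : Set G) := Subgroup.isClosed_of_isOpen U hUo
  haveI : CompactSpace Cs := isCompact_iff_compactSpace.mp hCsc.isCompact
  have hDo : IsOpen (D : Set Cs) := hUo.preimage continuous_subtype_val
  haveI : Finite (Cs ⧸ D) := Subgroup.quotient_finite_of_isOpen D hDo
  haveI hDfi : D.FiniteIndex := Subgroup.finiteIndex_of_finite_quotient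
  set m : ℕ := D.index with hm
  have hm0 : 0 < m := Nat.pos_of_ne_zero hDfi.index_ne_zero
  -- `t ∈ Cs`
  have htS : t ∈ S := Subgroup.mem_sup_left (Subgroup.mem_zpowers t)
  have htCs : t ∈ Cs := S.le_topologicalClosure htS
  have hPCs : P ≤ Cs := fun x hx => S.le_topologicalClosure (Subgroup.mem_sup_right hx)
  -- `t ^ m ∈ U`
  have htm : t ^ m ∈ U := by
    have h := Subgroup.pow_index_mem D (⟨t, htCs⟩ : Cs)
    rw [Subgroup.mem_subgroupOf] at h
    simpa using h
  refine ⟨m, hm0, htm, ?_⟩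
  set E : Subgroup G := (Subgroup.zpowers (t ^ m) ⊔ P).topologicalClosure with hE
  have hEc : IsClosed (E : Set G) := (Subgroup.zpowers (t ^ m) ⊔ P).isClosed_topologicalClosure
  have hE_eq : (E : Set G) = closure ((Subgroup.zpowers (t ^ m) ⊔ P : Subgroup G) : Set G) := rfl
  rw [← hE_eq, ← hCs_eq]
  -- `E ≤ Cs ⊓ U`
  have hEle : E ≤ Cs ⊓ U := by
    rw [hE]
    refine (Subgroup.topologicalClosure_minimal _ ?_ (hCsc.inter hUc))
    refine sup_le ?_ (le_inf hPCs hPU)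
    rw [Subgroup.zpowers_le]
    exact ⟨Subgroup.pow_mem _ htCs m, htm⟩
  apply Set.Subset.antisymm _ (fun x hx => hEle hx)
  -- every element of `Cs` is `t ^ a * d` with `d ∈ Cs ∩ U`
  have hrep : ∀ c ∈ Cs, ∃ a : ℤ, ∃ u ∈ U, c = t ^ a * u := by
    intro c hc
    obtain ⟨y, hy, u, hu, rfl⟩ := Set.mem_mul.mp (closure_subset_mul_of_isOpen (S : Set G) U hUo hc)
    have hy' : y ∈ ((Subgroup.zpowers t ⊔ P : Subgroup G) : Set G) := hy
    rw [Subgroup.mul_normal] at hy'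
    obtain ⟨z, hz, q, hq, rfl⟩ := Set.mem_mul.mp hy'
    obtain ⟨a, rfl⟩ := Subgroup.mem_zpowers_iff.mp hz
    exact ⟨a, q * u, U.mul_mem (hPU hq) hu, by group⟩
  -- the order of the image of `t` in `Cs ⧸ D` is `m`
  let tb : Cs ⧸ D := QuotientGroup.mk ⟨t, htCs⟩
  have hgen : ∀ q : Cs ⧸ D, q ∈ Subgroup.zpowers tb := by
    intro q
    obtain ⟨⟨c, hc⟩, rfl⟩ := QuotientGroup.mk_surjective q
    obtain ⟨a, u, hu, hcu⟩ := hrep c hc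
    have huCs : u ∈ Cs := by
      have : u = (t ^ a)⁻¹ * c := by rw [hcu]; group
      rw [this]; exact Cs.mul_mem (Cs.inv_mem (Cs.zpow_mem htCs a)) hc
    refine ⟨a, ?_⟩
    change tb ^ a = QuotientGroup.mk ⟨c, hc⟩
    rw [← QuotientGroup.mk_zpow]
    apply Eq.symm
    rw [QuotientGroup.eq, Subgroup.mem_subgroupOf]
    have : (((⟨c, hc⟩ : Cs)⁻¹ * (⟨t, htCs⟩ : Cs) ^ a : Cs) : G) = u⁻¹ := by
      simp only [Subgroup.coe_mul, Subgroup.coe_inv, SubgroupClass.coe_zpow, hcu]; group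
    rw [this]; exact U.inv_mem hu
  have htop : Subgroup.zpowers tb = ⊤ := (Subgroup.eq_top_iff' _).mpr hgen
  have hord : orderOf tb = m := by
    rw [← Nat.card_zpowers, htop, Subgroup.card_top, hm, Subgroup.index_eq_card]
  -- `Cs ⊆ ⋃_{i<m} t^i • E`
  have hcover : (Cs : Set G) ⊆ ⋃ i : Fin m, t ^ (i : ℕ) • (E : Set G) := by
    have hclosed : IsClosed (⋃ i : Fin m, t ^ (i : ℕ) • (E : Set G)) :=
      isClosed_iUnion_of_finite fun i => hEc.smul _
    rw [hCs_eq]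
    refine closure_minimal ?_ hclosed
    intro y hy
    have hy' : y ∈ ((Subgroup.zpowers t ⊔ P : Subgroup G) : Set G) := hy
    rw [Subgroup.mul_normal] at hy'
    obtain ⟨z, hz, q, hq, rfl⟩ := Set.mem_mul.mp hy'
    obtain ⟨a, rfl⟩ := Subgroup.mem_zpowers_iff.mp hz
    -- `t ^ a = t ^ i * (t ^ m) ^ k` with `i = a mod m`
    have hm0' : (m : ℤ) ≠ 0 := by exact_mod_cast hm0.ne'
    refine Set.mem_iUnion.mpr ⟨⟨(a % m).toNat, by
      have h1 : 0 ≤ a % m := Int.emod_nonneg _ hm0'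
      have h2 : a % m < m := Int.emod_lt_of_pos _ (by exact_mod_cast hm0)
      omega⟩, ?_⟩
    refine ⟨(t ^ (m : ℕ)) ^ (a / m) * q, ?_, ?_⟩
    · exact (Subgroup.zpowers (t ^ m) ⊔ P).le_topologicalClosure
        (Subgroup.mul_mem _ (Subgroup.mem_sup_left (Subgroup.zpow_mem_zpowers _ _))
          (Subgroup.mem_sup_right hq))
    · change t ^ ((a % m).toNat) * ((t ^ m) ^ (a / m) * q) = t ^ a * q
      have h1 : 0 ≤ a % m := Int.emod_nonneg _ hm0'
      have key : t ^ ((a % m).toNat) * (t ^ m) ^ (a / m) = t ^ a := by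
        have hdecomp : ((a % m).toNat : ℤ) + (m : ℤ) * (a / m) = a := by
          rw [Int.toNat_of_nonneg h1]; exact Int.emod_add_mul_ediv a m
        conv_rhs => rw [← hdecomp, zpow_add, zpow_mul]
        rw [zpow_natCast, zpow_natCast]
      rw [← mul_assoc, key]
  -- conclude: `x ∈ Cs ∩ U` lies in `E`
  rintro x ⟨hxCs, hxU⟩
  obtain ⟨i, hxi⟩ := Set.mem_iUnion.mp (hcover hxCs)
  obtain ⟨e, he, rfl⟩ := hxi
  simp only [smul_eq_mul] at hxCs hxU ⊢
  -- `t ^ i ∈ U`, hence `m ∣ i`, hence `i = 0`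
  have heU : e ∈ U := (hEle he).2
  have htiU : t ^ (i : ℕ) ∈ U := by
    have : t ^ (i : ℕ) = (t ^ (i : ℕ) * e) * e⁻¹ := by group
    rw [this]; exact U.mul_mem hxU (U.inv_mem heU)
  have hti : tb ^ (i : ℕ) = 1 := by
    change (QuotientGroup.mk (⟨t, htCs⟩ : Cs) : Cs ⧸ D) ^ (i : ℕ) = 1
    rw [← QuotientGroup.mk_pow, QuotientGroup.eq_one_iff, Subgroup.mem_subgroupOf]
    simpa using htiU
  have hdvd : orderOf tb ∣ (i : ℕ) := orderOf_dvd_of_pow_eq_one hti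
  rw [hord] at hdvd
  have hi0 : (i : ℕ) = 0 := Nat.eq_zero_of_dvd_of_lt hdvd i.2
  rw [hi0, pow_zero, one_mul]
  exact he

end Literature.GroupTheory
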